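/-
Copyright (c) 2026 the pub-hodgecm-mathlib formalisation cell (harness21).  Prover seat hodgecm-mathlib-K2E3-p23 (g5), HCML Track B «K2-LIT» ∕ h413
(`stmt-HodgeConjecture-24833`), line `K2_E3_EllipticInputs`, unit U12 «Characters», road «GL-[M6]-sc» (line lead K2E3-p23 (g5), dealer K2E3-plan (g3)),
MEMO «M6sc-BLUEPRINT v4» §2 brick VOL-mixed, CORE COUNT — FILE 2: the SHARP count in the `k·n·a` (right-Haar) orientation.  2026-09-04.
-/
import Summits.HodgeConjecture.HodgeConjecture.Theorems.K2E3GL2EllipticConjugacyCount   -- ★ FILE 1 (§1–§6): shells, `measure_normAbs_le_zpow`, §5, §6 anisotropy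
import HarnessLib

/-!
# Road «GL-[M6]-sc», brick VOL-mixed, CORE COUNT FILE 2: the SHARP weighted count
# `∫⁻_{(q⁻¹)^A ≤ |a|} |a| · μ{b : |a| Φ(b) ≤ (q⁻¹)^B} dμ'(a) ≤ n₊ · |s|⁻¹ · (q⁻¹)^{B − l + ⌊l/2⌋} · μ'(𝒪ˣ) · μ(𝒪)` under `Φ ≥ max((q⁻¹)^l, |s·b + t|²)`

Cell `pub/hodgecm-mathlib` (D-0151), Track B «K2-LIT», crux H413 = `stmt-HodgeConjecture-24833`, route of record `HCCMUnconditional`.  Lane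
`--supports stmt-HodgeConjecture-24833 --as helper`; THEOREMS ONLY (no `def`, no `instance`, no `notation`, no named-fact hypothesis, no `sorry`); count-neutral.

WHY A SECOND FILE.  ★ FILE 1 §5 (`setLIntegral_normAbs_mul_measure_le`) counts the `k·n·a`-orientation under the hypothesis `(q⁻¹)^l max(1,|b|²) ≤ Φ(b)`, which is sharp for
`Φ = |w|·|Nm(1 − bτ)|` but LOSSY for the companion normalisation `Φ = |π(·)|` (RULINGS (M12-5)): it yields `(q⁻¹)^{B−l} ≍ q^m |disc π|⁻¹`.  For a ROOTLESS quadratic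
`π = X² − TX + N₀` the truth is `|π(b)| ≥ max(|disc π|, |2b − T|²)` (★ FILE 1 §6 `normAbs_discr_le_normAbs_eval` and `sq_normAbs_deriv_le_normAbs_eval` below — Hensel: if
`|π(x)| < |π′(x)|²` then `h² + π′(x)h = −π(x)` is solvable by ★ `K2E3LocalFieldSquaresHensel.exists_sq_add_mul_eq`), and under a hypothesis of THAT shape the `b`-sections
`{b : |a| Φ(b) ≤ (q⁻¹)^B}` are affine preimages of balls of radius `√((q⁻¹)^{B}/|a|)`, of mass `|s|⁻¹ q^{-(B−j)/2} μ(𝒪)` — so the weighted shells sum to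
`(q⁻¹)^{B − l/2} ≍ q^m |c| |disc π|^{-1/2}`: HARISH-CHANDRA'S THEOREM 14 FOR THE MIXED TORUS `T_E ⊂ GL₃(F)` WITH THE CORRECT EXPONENT, uniformly over all `π`.
* `sq_normAbs_deriv_le_normAbs_eval` — `|2x − T|² ≤ |π(x)|` for rootless `π`;
* `normAbs_le_zpow_of_sq_le` — `|y|² ≤ (q⁻¹)^t ⇒ |y| ≤ (q⁻¹)^{⌈t/2⌉}`;
* `measure_setOf_mul_le_of_sq_le` — the `b`-section bound `μ{b : |a|Φ(b) ≤ (q⁻¹)^B} ≤ |s|⁻¹ q^{⌈-(B−j)/2⌉…} μ(𝒪)` (Tate's `μ(aM) = |a|μ(M)` for `b ↦ s b + t`);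
* `normAbs_mul_measure_setOf_mul_le_of_sq_le` — one weighted shell `≤ |s|⁻¹ (q⁻¹)^{B − l + ⌊l/2⌋} μ(𝒪)` (zero for `j < B − l`);
* **`setLIntegral_normAbs_mul_measure_le_of_sq_le`** — THE HEAD.
HONEST LABEL: HC_CM is proved only modulo the 7 printed citations (2 remaining named inputs: hLiu418 = stmt-HodgeConjecture-24832, h413 = stmt-HodgeConjecture-24833) until
rung 0 closes; count-neutral helper, closes no socket.

## References
* [HarishChandra1970] Harish-Chandra (notes by G. van Dijk), *Harmonic Analysis on Reductive p-adic Groups*, LNM 162 (1970), Part VII §1 Theorem 14 p. 60, §3 p. 72.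
* [Tate1950] J. Tate, *Fourier analysis in number fields and Hecke's zeta-functions* (1950), §2.2 Lemma 2.2.5, §2.5.
* [NeukirchANT1999] J. Neukirch, *Algebraic Number Theory* (1999), Ch. II §4 Lemma (4.6) (Hensel).
-/

set_option autoImplicit false
-- the mandated namespace repeats the single-problem summit's segment (`HodgeConjecture.HodgeConjecture`)
set_option linter.dupNamespace false

noncomputable section

open scoped NNReal ENNReal Pointwise
open MeasureTheory Set ValuativeRel Literature.NumberTheory.Automorphic Literature.NumberTheory.GaloisRepresentations.IsNonarchimedeanLocalField

namespace Summit.HodgeConjecture.HodgeConjecture.Cruxes.H413.K2E3GL2EllipticConjugacyCountSharp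

open K2E3GL2EllipticConjugacyCount

variable {F : Type*} [Field F] [ValuativeRel F] [TopologicalSpace F] [IsNonarchimedeanLocalField F] [MeasurableSpace F] [BorelSpace F]

/-! ## §1 The SHARP right-Haar count: `Φ(b) ≥ max((q⁻¹)^l, |s b + t|²)` ⇒ `∫⁻_{(q⁻¹)^A ≤ |a|} |a| μ{b : |a|Φ(b) ≤ (q⁻¹)^B} dμ' ≤ n₊ |s|⁻¹ (q⁻¹)^{⌈(2B−l)/2⌉} μ'(𝒪ˣ) μ(𝒪)`

§5's hypothesis `(q⁻¹)^l max(1,|b|²) ≤ Φ(b)` is sharp for `Φ = |w|·|Nm(1 − bτ)|` but LOSSY for the companion normalisation `Φ = |π(·)|` in the weighted orientation (it yields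
`(q⁻¹)^{B−l} ≍ q^m|disc π|⁻¹`).  The truth for a rootless quadratic is `|π(b)| ≥ max(|disc π|, |2b − T|²)` (§6 and Hensel again), and with a hypothesis of that shape the
`b`-sections are balls of radius `√((q⁻¹)^B/|a|)/|s|`, giving the correct size `(q⁻¹)^{B − l/2} ≍ q^m |disc π|^{-1/2}`. -/

omit [MeasurableSpace F] [BorelSpace F] in
/-- **`|π′(x)|² ≤ |π(x)|`**: `|2x − T|² ≤ |x² − Tx + N₀|` for every `x ∈ F` when `π = X² − TX + N₀` has no root in `F` (else `h² + π′(x)h = −π(x)` is solvable, ★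
`exists_sq_add_mul_eq`, and `x + h` is a root). [cite: NeukirchANT1999, Ch. II §4 Lemma (4.6)] -/
theorem sq_normAbs_deriv_le_normAbs_eval {T N₀ : F} (hπ : ∀ x : F, x ^ 2 - T * x + N₀ ≠ 0) (x : F) :
    normAbs F (2 * x - T) ^ 2 ≤ normAbs F (x ^ 2 - T * x + N₀) := by
  by_contra hlt
  push Not at hlt
  have ha : 2 * x - T ≠ 0 := by
    intro h0
    rw [h0, map_zero, zero_pow two_ne_zero] at hlt
    exact not_lt_bot hlt
  have hy : normAbs F (-(x ^ 2 - T * x + N₀)) < normAbs F (2 * x - T) ^ 2 := by rwa [normAbs_neg]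
  obtain ⟨h, hh, -⟩ := K2E3LocalFieldSquaresHensel.exists_sq_add_mul_eq ha hy
  exact hπ (x + h) (by linear_combination hh)

omit [MeasurableSpace F] [BorelSpace F] in
/-- `{y : |y|² ≤ (q⁻¹)^t} ⊆ {y : |y| ≤ (q⁻¹)^{-⌊-t/2⌋}}` (`= ⌈t/2⌉`; integrality of the exponents of `|·|`). [folklore] -/
theorem normAbs_le_zpow_of_sq_le {y : F} {t : ℤ} (h : normAbs F y ^ 2 ≤ ((residueFieldCard F : ℝ≥0)⁻¹) ^ t) :
    normAbs F y ≤ ((residueFieldCard F : ℝ≥0)⁻¹) ^ (-((-t) / 2)) := by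
  by_cases hy : y = 0
  · rw [hy, map_zero]; exact bot_le
  obtain ⟨k, hk⟩ := exists_normAbs_eq_inv_zpow hy
  rw [hk, ← zpow_natCast, ← zpow_mul, inv_residueFieldCard_zpow_le_iff] at h
  rw [hk, inv_residueFieldCard_zpow_le_iff]
  push_cast at h
  omega

/-- **The `b`-section under an affine-square lower bound**: if `|s b + t|² ≤ Φ(b)` for all `b` (`s ≠ 0`) then
`μ{b : |a| Φ(b) ≤ (q⁻¹)^B} ≤ |s|⁻¹ · (q⁻¹)^{-⌊-(B−j)/2⌋} · μ(𝒪)` for `|a| = (q⁻¹)^j` — a ball of radius `√((q⁻¹)^{B−j})` in the variable `s b + t`.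
[cite: HarishChandra1970, Part VII §3 p. 72] [cite: Tate1950, §2.2 Lemma 2.2.5] -/
theorem measure_setOf_mul_le_of_sq_le (μ : Measure F) [μ.IsAddHaarMeasure] {Φ : F → ℝ≥0} {s t : F} (hs : s ≠ 0)
    (hΦ₂ : ∀ b, normAbs F (s * b + t) ^ 2 ≤ Φ b) {a : Fˣ} {j : ℤ} (hj : normAbs F (a : F) = ((residueFieldCard F : ℝ≥0)⁻¹) ^ j) (B : ℤ) :
    μ {b : F | normAbs F (a : F) * Φ b ≤ ((residueFieldCard F : ℝ≥0)⁻¹) ^ B} ≤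
      (((normAbs F s)⁻¹ * (residueFieldCard F : ℝ≥0) ^ ((-(B - j)) / 2) : ℝ≥0) : ℝ≥0∞) * μ {b : F | normAbs F b ≤ 1} := by
  -- the section lies in the affine preimage of a ball
  set R : ℝ≥0 := ((residueFieldCard F : ℝ≥0)⁻¹) ^ (-((-(B - j)) / 2)) with hR
  have hsub : {b : F | normAbs F (a : F) * Φ b ≤ ((residueFieldCard F : ℝ≥0)⁻¹) ^ B} ⊆ (fun b => s * b + t) ⁻¹' {y : F | normAbs F y ≤ R} := by
    intro b hb
    have h1 : ((residueFieldCard F : ℝ≥0)⁻¹) ^ j * normAbs F (s * b + t) ^ 2 ≤ ((residueFieldCard F : ℝ≥0)⁻¹) ^ B := by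
      rw [← hj]; exact (mul_le_mul_of_nonneg_left (hΦ₂ b) bot_le).trans hb
    have h2 : normAbs F (s * b + t) ^ 2 ≤ ((residueFieldCard F : ℝ≥0)⁻¹) ^ (B - j) := by
      rw [zpow_sub₀ inv_residueFieldCard_pos.ne', le_div_iff₀ (zpow_pos inv_residueFieldCard_pos j), mul_comm]
      exact h1
    exact normAbs_le_zpow_of_sq_le h2
  -- the affine map `b ↦ s b + t` scales Haar measure by `|s|`
  have haff : μ ((fun b => s * b + t) ⁻¹' {y : F | normAbs F y ≤ R}) = ((normAbs F s)⁻¹ : ℝ≥0) * μ {y : F | normAbs F y ≤ R} := by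
    have hcomp : (fun b => s * b + t) ⁻¹' {y : F | normAbs F y ≤ R} = (fun b => s * b) ⁻¹' ((fun y => y + t) ⁻¹' {y : F | normAbs F y ≤ R}) := rfl
    rw [hcomp, ← Measure.map_apply (measurable_const_mul s) ((measurable_add_const t) (measurableSet_le LocalFieldHaar.measurable_normAbs measurable_const)),
      map_mul_left_addHaar μ hs, Measure.smul_apply, smul_eq_mul, map_inv₀, measure_preimage_add_right]
  calc μ {b : F | normAbs F (a : F) * Φ b ≤ ((residueFieldCard F : ℝ≥0)⁻¹) ^ B}
      ≤ μ ((fun b => s * b + t) ⁻¹' {y : F | normAbs F y ≤ R}) := measure_mono hsub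
    _ = ((normAbs F s)⁻¹ : ℝ≥0) * μ {y : F | normAbs F y ≤ R} := haff
    _ = _ := by rw [hR, measure_normAbs_le_zpow μ, ← mul_assoc, ← ENNReal.coe_mul]

/-- **One `a`-shell, SHARP**: under `(q⁻¹)^l ≤ Φ` and `|s b + t|² ≤ Φ(b)`, for `|a| = (q⁻¹)^j`:
`|a| · μ{b : |a| Φ(b) ≤ (q⁻¹)^B} ≤ |s|⁻¹ (q⁻¹)^{B − l + l/2} μ(𝒪)`, and `= 0` when `j < B − l`. [cite: HarishChandra1970, Part VII §3 p. 72] -/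
theorem normAbs_mul_measure_setOf_mul_le_of_sq_le (μ : Measure F) [μ.IsAddHaarMeasure] {Φ : F → ℝ≥0} {l : ℕ} {B : ℤ} {s t : F} (hs : s ≠ 0)
    (hΦ₁ : ∀ b, ((residueFieldCard F : ℝ≥0)⁻¹) ^ (l : ℤ) ≤ Φ b) (hΦ₂ : ∀ b, normAbs F (s * b + t) ^ 2 ≤ Φ b)
    {a : Fˣ} {j : ℤ} (hj : normAbs F (a : F) = ((residueFieldCard F : ℝ≥0)⁻¹) ^ j) :
    (normAbs F (a : F) : ℝ≥0∞) * μ {b : F | normAbs F (a : F) * Φ b ≤ ((residueFieldCard F : ℝ≥0)⁻¹) ^ B} ≤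
      (if j < B - l then 0 else (((normAbs F s)⁻¹ * ((residueFieldCard F : ℝ≥0)⁻¹) ^ (B - l + l / 2) : ℝ≥0) : ℝ≥0∞) * μ {b : F | normAbs F b ≤ 1}) := by
  split_ifs with hlt
  · -- empty section: `(q⁻¹)^{j+l} ≤ |a| Φ b ≤ (q⁻¹)^B` forces `B ≤ j + l`
    have h0 : {b : F | normAbs F (a : F) * Φ b ≤ ((residueFieldCard F : ℝ≥0)⁻¹) ^ B} = ∅ := by
      refine Set.eq_empty_of_subset_empty fun b hb => ?_
      have h1 : ((residueFieldCard F : ℝ≥0)⁻¹) ^ j * ((residueFieldCard F : ℝ≥0)⁻¹) ^ (l : ℤ) ≤ ((residueFieldCard F : ℝ≥0)⁻¹) ^ B := by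
        rw [← hj]; exact (mul_le_mul_of_nonneg_left (hΦ₁ b) bot_le).trans hb
      rw [← zpow_add₀ inv_residueFieldCard_pos.ne', inv_residueFieldCard_zpow_le_iff] at h1
      exact absurd h1 (by omega)
    rw [h0, measure_empty, mul_zero]
  · push Not at hlt
    calc (normAbs F (a : F) : ℝ≥0∞) * μ {b : F | normAbs F (a : F) * Φ b ≤ ((residueFieldCard F : ℝ≥0)⁻¹) ^ B}
        ≤ (normAbs F (a : F) : ℝ≥0∞) * ((((normAbs F s)⁻¹ * (residueFieldCard F : ℝ≥0) ^ ((-(B - j)) / 2) : ℝ≥0) : ℝ≥0∞) * μ {b : F | normAbs F b ≤ 1}) :=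
          mul_le_mul_of_nonneg_left (measure_setOf_mul_le_of_sq_le μ hs hΦ₂ hj B) bot_le
      _ = (((normAbs F s)⁻¹ * (((residueFieldCard F : ℝ≥0)⁻¹) ^ j * (residueFieldCard F : ℝ≥0) ^ ((-(B - j)) / 2)) : ℝ≥0) : ℝ≥0∞) *
            μ {b : F | normAbs F b ≤ 1} := by
          rw [hj, ← mul_assoc, ← ENNReal.coe_mul]; congr 2; ring
      _ ≤ (((normAbs F s)⁻¹ * ((residueFieldCard F : ℝ≥0)⁻¹) ^ (B - l + l / 2) : ℝ≥0) : ℝ≥0∞) * μ {b : F | normAbs F b ≤ 1} := by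
          gcongr
          have h2 : (residueFieldCard F : ℝ≥0) ^ ((-(B - j)) / 2) = ((residueFieldCard F : ℝ≥0)⁻¹) ^ (-((-(B - j)) / 2)) := by
            rw [inv_zpow', neg_neg]
          rw [h2, ← zpow_add₀ inv_residueFieldCard_pos.ne', inv_residueFieldCard_zpow_le_iff]
          omega

/-- **THE SHARP RIGHT-HAAR COUNT**: if `(q⁻¹)^l ≤ Φ(b)` and `|s b + t|² ≤ Φ(b)` for all `b` (`s ≠ 0`), then
`∫⁻_{a : (q⁻¹)^A ≤ |a|} |a| · μ{b : |a| Φ(b) ≤ (q⁻¹)^B} dμ'(a) ≤ n₊ · |s|⁻¹ · (q⁻¹)^{B − l + ⌊l/2⌋} · μ'(𝒪ˣ) · μ(𝒪)`, `n = A − B + l + 1`.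
For the companion normal form (`Φ = |π(·)|`, `(q⁻¹)^l ≈ |disc π|`, `s = 2`, `t = −T` by §6∕`sq_normAbs_deriv_le_normAbs_eval`, `(q⁻¹)^B = q^m|c|`) this is
`≍ n · q^m |c| · |2|⁻¹ · |disc π|^{-1/2}` = Theorem 14 for `T_E ⊂ GL₂(F)` with the CORRECT exponent `−1/2` in the `k·n·a` orientation.
[cite: HarishChandra1970, Part VII §1 Theorem 14 p. 60; §3 p. 72] [cite: Tate1950, §2.5] -/
theorem setLIntegral_normAbs_mul_measure_le_of_sq_le (μ' : Measure Fˣ) [μ'.IsMulLeftInvariant] (μ : Measure F) [μ.IsAddHaarMeasure] {Φ : F → ℝ≥0}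
    {l : ℕ} {A B : ℤ} {s t : F} (hs : s ≠ 0)
    (hΦ₁ : ∀ b, ((residueFieldCard F : ℝ≥0)⁻¹) ^ (l : ℤ) ≤ Φ b) (hΦ₂ : ∀ b, normAbs F (s * b + t) ^ 2 ≤ Φ b) :
    ∫⁻ a in {a : Fˣ | ((residueFieldCard F : ℝ≥0)⁻¹) ^ A ≤ normAbs F (a : F)},
        (normAbs F (a : F) : ℝ≥0∞) * μ {b : F | normAbs F (a : F) * Φ b ≤ ((residueFieldCard F : ℝ≥0)⁻¹) ^ B} ∂μ' ≤
      ((A - B + l + 1).toNat : ℝ≥0∞) * (((normAbs F s)⁻¹ * ((residueFieldCard F : ℝ≥0)⁻¹) ^ (B - l + l / 2) : ℝ≥0) : ℝ≥0∞) *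
        μ' {x : Fˣ | valuation F (x : F) = 1} * μ {b : F | normAbs F b ≤ 1} := by
  haveI : BorelSpace Fˣ := Units.borelSpace
  set S : Set Fˣ := {a : Fˣ | ((residueFieldCard F : ℝ≥0)⁻¹) ^ A ≤ normAbs F (a : F)} with hS
  set U : Set Fˣ := ⋃ j ∈ Finset.Icc (B - l) A, {x : Fˣ | normAbs F (x : F) = ((residueFieldCard F : ℝ≥0)⁻¹) ^ j} with hU
  set c : ℝ≥0∞ := (((normAbs F s)⁻¹ * ((residueFieldCard F : ℝ≥0)⁻¹) ^ (B - l + l / 2) : ℝ≥0) : ℝ≥0∞) * μ {b : F | normAbs F b ≤ 1} with hc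
  have hSm : MeasurableSet S :=
    measurableSet_le measurable_const (LocalFieldHaar.measurable_normAbs.comp Units.continuous_val.measurable)
  have hUm : MeasurableSet U := Finset.measurableSet_biUnion _ fun j _ => measurableSet_normAbs_shell j
  have hpt : ∀ a ∈ S, (normAbs F (a : F) : ℝ≥0∞) * μ {b : F | normAbs F (a : F) * Φ b ≤ ((residueFieldCard F : ℝ≥0)⁻¹) ^ B} ≤
      U.indicator (fun _ => c) a := by
    intro a ha
    obtain ⟨j, hj⟩ := exists_normAbs_eq_inv_zpow a.ne_zero
    have ha' : ((residueFieldCard F : ℝ≥0)⁻¹) ^ A ≤ normAbs F (a : F) := ha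
    rw [hj] at ha'
    have hjA : j ≤ A := inv_residueFieldCard_zpow_le_iff.1 ha'
    refine (normAbs_mul_measure_setOf_mul_le_of_sq_le μ hs hΦ₁ hΦ₂ hj (B := B)).trans ?_
    split_ifs with hlt
    · exact bot_le
    · have haU : a ∈ U := Set.mem_biUnion (Finset.mem_Icc.2 ⟨by omega, hjA⟩) hj
      rw [Set.indicator_of_mem haU]
  calc ∫⁻ a in S, (normAbs F (a : F) : ℝ≥0∞) * μ {b : F | normAbs F (a : F) * Φ b ≤ ((residueFieldCard F : ℝ≥0)⁻¹) ^ B} ∂μ'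
      ≤ ∫⁻ a in S, U.indicator (fun _ => c) a ∂μ' := setLIntegral_mono' hSm hpt
    _ = c * μ'.restrict S U := by rw [lintegral_indicator_const hUm]
    _ ≤ c * μ' U := mul_le_mul_of_nonneg_left (Measure.restrict_apply_le S U) bot_le
    _ ≤ c * (((A - B + l + 1).toNat : ℝ≥0∞) * μ' {x : Fˣ | valuation F (x : F) = 1}) := by
        gcongr
        refine (measure_biUnion_finset_le _ _).trans ?_
        simp only [measure_shell μ']
        rw [Finset.sum_const, nsmul_eq_mul, Int.card_Icc]
        gcongr
        norm_cast
        omega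
    _ = _ := by rw [hc]; ring

end Summit.HodgeConjecture.HodgeConjecture.Cruxes.H413.K2E3GL2EllipticConjugacyCountSharp

end
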